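import Summits.MatrixMultiplication.MatrixMultiplication.Theses.TetrahedronCarving
import Summits.MatrixMultiplication.MatrixMultiplication.Theorems.TetrahedronTensorRectangular
import HarnessLib

/-!
# TetraDiagonalCore — the thin-diagonal tetrahedra `Z_n^{(d)}`: restriction and grouping

(decomp-mm lens 6 «barrier-complement carving», generation 19; kernel A1 of NODE-g19. The cut of record
`ω = 2 ⟺ TetraFlat ∧ TetraNoSaving` (route `TetrahedronCarving`, items 33477 / 33478) is UNCHANGED;
the `TetraDiagonal*` files add THEOREMS about its two leaves, no item.)

THE OBJECT. For `1 ≤ d ≤ n`, the THIN-DIAGONAL TETRAHEDRON `Z_n^{(d)} ∈ (F^{n³})^{⊗4}` is the graph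
tensor of `K₄` whose perfect matching `{01, 23}` (the two "diagonals" of the square `0 2 1 3`) carries
EPR pairs of size `d` and whose complementary 4-cycle `02, 03, 12, 13` carries EPR pairs of size `n`
(Christandl–Vrana–Zuiddam, arXiv:1609.07476, Ex. 1.1.2 with a non-uniform dimension function). It is
realised INSIDE the format of `T(K₄)_n` (`tetra`) by restricting the labels of the two matching edges
to `{0,…,d-1}` — a leg-wise `{0,1}`-diagonal restriction (`diagTetra n d = (∏_v χ_v) · tetra n`), so
`d = n` is the tetrahedron itself (`diagTetra_self`) and `d = 1` is the padded 4-cycle `C₄`.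

WHAT IS PROVED (every field; sorry-free, no new axiom / instance / notation / Prop-def):
* §1 `tensorRankD_legMul_le`: multiplying a tensor leg-wise by arbitrary functions (restriction by
  diagonal matrices) does not increase `tensorRankD`. [folklore]
* §2 `diagTetra`, `diagTetra_self`, `tensorRankD_diagTetra_le_tetra : R₄(Z_n^{(d)}) ≤ R₄(T(K₄)_n)`,
  `tensorRankD_diagTetra_mono` (monotone in `d`), `exists_rankOne_decomposition_diagTetra`.
* §3 GROUPING `{0,1} | 2 | 3` (thin edge `01` frozen, thin edge `23` the middle index):
  `diagTetra_dLabels` (the grouped tensor read at a point of `⟨N², d, N²⟩` is that matrix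
  multiplication tensor) and `tensorRank_matMulTensor_le_tensorRankD_diagTetra :
  R(⟨N², d, N²⟩) ≤ R₄(Z_N^{(d)})` (`1 ≤ d ≤ N`).
* §3b the definitions used downstream: `diagAdmissibleExponents` / `omegaDiag` (the exponent
  `ω_diag(ε)` of `n ↦ Z_n^{(⌈n^ε⌉)}`, CVZ19 Def. 1.1.13/1.1.25 with a non-uniform dimension function) and
  the 4-cycle label maps `cycExt` / `cycDec`.
Continued in `TetraDiagonalLadder` (exponent `ω_diag(ε)`, bracket, ladder under `TetraFlat`) and
`TetraDiagonalCover` (Kronecker structure, `ω_diag(ε) ≤ 4(1-ε) + ε·ω(K₄)`).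
Sources: [corpus:paper-arxiv-1609.07476 Ex. 1.1.2, Prop. 1.1.16] · tree `TetrahedronTensor{Core,Rectangular}`.
-/

noncomputable section

set_option linter.dupNamespace false

open scoped BigOperators
open Filter Asymptotics
open Literature.Computability.AlgebraicComplexity
open Summit.MatrixMultiplication.MatrixMultiplication.Theorems.TetrahedronTensor
open Summit.MatrixMultiplication.MatrixMultiplication.Theses.TetrahedronCarving

namespace Summit.MatrixMultiplication.MatrixMultiplication.Theorems.TetraDiagonal

/-! ## §1 Leg-wise restriction does not increase rank -/

section LegMul

variable {F : Type*} [Field F]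

/-- From a shortest rank-one decomposition of `T`, a rank-one decomposition of the leg-wise product
`(∏_v χ_v(i_v)) · T(i)` of the same length (restriction by diagonal matrices on every leg). [folklore] -/
theorem exists_decomposition_legMul {d N : ℕ} (T : (Fin d → Fin N) → F) (χ : Fin d → Fin N → F)
    (hT : ∃ s : ℕ, ∃ g : Fin s → ((Fin d → Fin N) → F),
      (∀ k, g k ∈ rankOneTensors F N d) ∧ ∑ k, g k = T) :
    ∃ u : Fin (tensorRankD T) → Fin d → Fin N → F,
      ∑ k, rankOneTensor (u k) = fun i => (∏ v, χ v (i v)) * T i := by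
  classical
  obtain ⟨g, hg, hsum⟩ := sComplexity_spec hT
  simp only [rankOneTensors, Set.mem_range] at hg
  choose u hu using hg
  refine ⟨fun k v x => χ v x * u k v x, ?_⟩
  funext i
  have h := congrFun hsum i
  rw [Finset.sum_apply] at h
  rw [Finset.sum_apply, ← h, Finset.mul_sum]
  refine Finset.sum_congr rfl fun k _ => ?_
  rw [← hu k, rankOneTensor_apply, rankOneTensor_apply, Finset.prod_mul_distrib]

/-- **Leg-wise restriction is rank-monotone**: `R(diag(χ₀) ⊗ ⋯ ⊗ diag(χ_{d-1}) · T) ≤ R(T)`. [folklore] -/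
theorem tensorRankD_legMul_le {d N : ℕ} (T : (Fin d → Fin N) → F) (χ : Fin d → Fin N → F)
    (hT : ∃ s : ℕ, ∃ g : Fin s → ((Fin d → Fin N) → F),
      (∀ k, g k ∈ rankOneTensors F N d) ∧ ∑ k, g k = T) :
    tensorRankD (fun i => (∏ v, χ v (i v)) * T i) ≤ tensorRankD T := by
  obtain ⟨u, hu⟩ := exists_decomposition_legMul T χ hT
  exact tensorRankD_le_of_eq_sum u hu

/-- The leg-wise product is again decomposable (so its `tensorRankD` is a genuine minimum). [folklore] -/
theorem legMul_decomposable {d N : ℕ} (T : (Fin d → Fin N) → F) (χ : Fin d → Fin N → F)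
    (hT : ∃ s : ℕ, ∃ g : Fin s → ((Fin d → Fin N) → F),
      (∀ k, g k ∈ rankOneTensors F N d) ∧ ∑ k, g k = T) :
    ∃ s : ℕ, ∃ g : Fin s → ((Fin d → Fin N) → F),
      (∀ k, g k ∈ rankOneTensors F N d) ∧ ∑ k, g k = fun i => (∏ v, χ v (i v)) * T i := by
  obtain ⟨u, hu⟩ := exists_decomposition_legMul T χ hT
  exact ⟨_, fun k => rankOneTensor (u k), fun k => rankOneTensor_mem _, hu⟩

end LegMul

/-! ## §2 The thin-diagonal tetrahedron `Z_n^{(d)}` -/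

section Tensor

variable (F : Type*) [Field F]

/-- Thin-slot indicator: `1` if the `j`-th label of the leg index `x` (a label triple, via
`finFunctionFinEquiv`) is `< d`, else `0`. -/
def thinInd (n d : ℕ) (j : Fin 3) (x : Fin (n ^ 3)) : F :=
  if ((finFunctionFinEquiv.symm x j : Fin n) : ℕ) < d then 1 else 0

/-- The four leg-wise restriction functions of the thin-diagonal tetrahedron: vertex `0` restricts its
slot `0` (edge `01`), vertex `2` its slot `2` (edge `23`); vertices `1, 3` are unrestricted (their copies
of the two matching labels are tied to the restricted ones by consistency). -/
def thinLegs (n d : ℕ) : Fin 4 → Fin (n ^ 3) → F :=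
  ![thinInd F n d 0, fun _ => 1, thinInd F n d 2, fun _ => 1]

/-- **The thin-diagonal tetrahedron** `Z_n^{(d)}`: the graph tensor of `K₄` with EPR pairs of size `d` on
the perfect matching `{01, 23}` and of size `n` on the 4-cycle `02, 03, 12, 13`, inside the format of
`T(K₄)_n` (matching labels restricted to `< d`). (CVZ19 Ex. 1.1.2, non-uniform dimensions). -/
def diagTetra (n d : ℕ) : (Fin 4 → Fin (n ^ 3)) → F :=
  fun i => (∏ v, thinLegs F n d v (i v)) * tetra F n i

variable {F}

/-- The leg product of `thinLegs` is the product of the two matching indicators. -/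
theorem prod_thinLegs {n d : ℕ} (i : Fin 4 → Fin (n ^ 3)) :
    ∏ v, thinLegs F n d v (i v) = thinInd F n d 0 (i 0) * thinInd F n d 2 (i 2) := by
  rw [Fin.prod_univ_four]
  simp [thinLegs]

/-- For `d ≥ n` no label is restricted. -/
theorem thinInd_of_le {n d : ℕ} (h : n ≤ d) (j : Fin 3) (x : Fin (n ^ 3)) :
    thinInd F n d j x = 1 := by
  unfold thinInd
  rw [if_pos]
  exact lt_of_lt_of_le (Fin.is_lt _) h

/-- Nested restrictions: `χ_d · χ_{d'} = χ_d` for `d ≤ d'`. -/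
theorem thinInd_mul_thinInd_of_le {n d d' : ℕ} (h : d ≤ d') (j : Fin 3) (x : Fin (n ^ 3)) :
    thinInd F n d j x * thinInd F n d' j x = thinInd F n d j x := by
  unfold thinInd
  by_cases hx : ((finFunctionFinEquiv.symm x j : Fin n) : ℕ) < d
  · rw [if_pos hx, if_pos (lt_of_lt_of_le hx h), one_mul]
  · rw [if_neg hx, zero_mul]

/-- `Z_n^{(d)} = T(K₄)_n` as soon as `d ≥ n`. -/
theorem diagTetra_of_le {n d : ℕ} (h : n ≤ d) : diagTetra F n d = tetra F n := by
  funext i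
  unfold diagTetra
  rw [prod_thinLegs, thinInd_of_le h, thinInd_of_le h, one_mul, one_mul]

/-- `Z_n^{(n)} = T(K₄)_n`: the top of the diagonal family is the tetrahedron. -/
theorem diagTetra_self (n : ℕ) : diagTetra F n n = tetra F n :=
  diagTetra_of_le le_rfl

/-- Nested thinning: `Z^{(d)} = χ_d · Z^{(d')}` for `d ≤ d'`. -/
theorem diagTetra_eq_legMul_diagTetra {n d d' : ℕ} (h : d ≤ d') :
    diagTetra F n d = fun i => (∏ v, thinLegs F n d v (i v)) * diagTetra F n d' i := by
  funext i
  simp only [diagTetra, prod_thinLegs]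
  have h0 := thinInd_mul_thinInd_of_le (F := F) h 0 (i 0)
  have h2 := thinInd_mul_thinInd_of_le (F := F) h 2 (i 2)
  calc thinInd F n d 0 (i 0) * thinInd F n d 2 (i 2) * tetra F n i
      = (thinInd F n d 0 (i 0) * thinInd F n d' 0 (i 0)) *
          (thinInd F n d 2 (i 2) * thinInd F n d' 2 (i 2)) * tetra F n i := by rw [h0, h2]
    _ = thinInd F n d 0 (i 0) * thinInd F n d 2 (i 2) *
          (thinInd F n d' 0 (i 0) * thinInd F n d' 2 (i 2) * tetra F n i) := by ring

/-- **`R₄(Z_n^{(d)}) ≤ R₄(T(K₄)_n)`**: the thin-diagonal tetrahedron is a leg-wise restriction of the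
tetrahedron. [folklore] -/
theorem tensorRankD_diagTetra_le_tetra (n d : ℕ) :
    tensorRankD (diagTetra F n d) ≤ tensorRankD (tetra F n) :=
  tensorRankD_legMul_le (tetra F n) (thinLegs F n d) (tetra_decomposable n)

/-- `Z_n^{(d)}` decomposes over rank-one tensors. -/
theorem diagTetra_decomposable (n d : ℕ) :
    ∃ s : ℕ, ∃ g : Fin s → ((Fin 4 → Fin (n ^ 3)) → F),
      (∀ k, g k ∈ rankOneTensors F (n ^ 3) 4) ∧ ∑ k, g k = diagTetra F n d :=
  legMul_decomposable (tetra F n) (thinLegs F n d) (tetra_decomposable n)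

/-- A rank-one decomposition of `Z_n^{(d)}` of length exactly `R₄(Z_n^{(d)})`. [folklore] -/
theorem exists_rankOne_decomposition_diagTetra (n d : ℕ) :
    ∃ u : Fin (tensorRankD (diagTetra F n d)) → Fin 4 → Fin (n ^ 3) → F,
      ∑ k, rankOneTensor (u k) = diagTetra F n d := by
  classical
  obtain ⟨g, hg, hs⟩ := sComplexity_spec (diagTetra_decomposable (F := F) n d)
  simp only [rankOneTensors, Set.mem_range] at hg
  choose u hu using hg
  have h : ∑ k, rankOneTensor (u k) = ∑ k, g k := Finset.sum_congr rfl fun k _ => hu k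
  exact ⟨u, h.trans hs⟩

/-- **Monotone in the diagonal size**: `R₄(Z_n^{(d)}) ≤ R₄(Z_n^{(d')})` for `d ≤ d'`. [folklore] -/
theorem tensorRankD_diagTetra_mono {n d d' : ℕ} (h : d ≤ d') :
    tensorRankD (diagTetra F n d) ≤ tensorRankD (diagTetra F n d') := by
  rw [diagTetra_eq_legMul_diagTetra (F := F) h]
  exact tensorRankD_legMul_le _ _ (diagTetra_decomposable n d')

end Tensor

/-! ## §3 Grouping `{0,1} | 2 | 3`: `R(⟨n², d, n²⟩) ≤ R₄(Z_n^{(d)})` -/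

section Grouping

variable {F : Type*} [Field F]

/-- The vertex label triples of the grouped thin-diagonal tetrahedron read off a point `(a, b, c)` of
`⟨N², d, N²⟩`: as `groupLabels` (edge `01` frozen to `0`), the middle index `b.2 = c.1 ∈ Fin d` being
the label of the thin edge `23`, embedded in `Fin N`. -/
def dLabels {N d : ℕ} [NeZero N] (hdN : d ≤ N) (a : Fin (N * N) × Fin (N * N))
    (b : Fin (N * N) × Fin d) (c : Fin d × Fin (N * N)) : Fin 4 → Fin 3 → Fin N :=
  groupLabels a (b.1, Fin.castLE hdN b.2) (Fin.castLE hdN c.1, c.2)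

/-- **The grouped thin-diagonal tetrahedron is `⟨N², d, N²⟩`** (`1 ≤ d ≤ N`). [folklore] -/
theorem diagTetra_dLabels {N d : ℕ} [NeZero N] (hd : 0 < d) (hdN : d ≤ N)
    (a : Fin (N * N) × Fin (N * N)) (b : Fin (N * N) × Fin d) (c : Fin d × Fin (N * N)) :
    diagTetra F N d (fun v => enc (dLabels hdN a b c v 0) (dLabels hdN a b c v 1)
        (dLabels hdN a b c v 2)) = matMulTensor F (N * N) d (N * N) a b c := by
  unfold diagTetra
  rw [prod_thinLegs]
  have h00 : dLabels hdN a b c 0 0 = 0 := by simp [dLabels, groupLabels]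
  have h22 : dLabels hdN a b c 2 2 = Fin.castLE hdN b.2 := by simp [dLabels, groupLabels]
  have h0 : thinInd F N d 0 (enc (dLabels hdN a b c 0 0) (dLabels hdN a b c 0 1)
      (dLabels hdN a b c 0 2)) = 1 := by
    simp only [thinInd, symm_enc, Matrix.cons_val_zero, h00]
    rw [if_pos]
    simpa using hd
  have h2 : thinInd F N d 2 (enc (dLabels hdN a b c 2 0) (dLabels hdN a b c 2 1)
      (dLabels hdN a b c 2 2)) = 1 := by
    simp only [thinInd, symm_enc, h22]
    rw [if_pos]
    simp
  rw [h0, h2, one_mul, one_mul]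
  unfold dLabels
  rw [tetra_groupLabels]
  simp only [matMulTensor]
  refine if_congr ?_ rfl rfl
  rw [(Fin.castLE_injective hdN).eq_iff]

/-- **Grouping lower-bound transfer** `R(⟨N², d, N²⟩) ≤ R₄(Z_N^{(d)})` (`1 ≤ d ≤ N`). [folklore] -/
theorem tensorRank_matMulTensor_le_tensorRankD_diagTetra {N d : ℕ} [NeZero N] (hd : 0 < d)
    (hdN : d ≤ N) :
    tensorRank (matMulTensor F (N * N) d (N * N)) ≤ tensorRankD (diagTetra F N d) := by
  classical
  obtain ⟨u, hu⟩ := exists_rankOne_decomposition_diagTetra (F := F) N d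
  refine tensorRank_le_of_eq_sum
    (fun k (a : Fin (N * N) × Fin (N * N)) =>
      u k 0 (enc 0 (finProdFinEquiv.symm a.1).1 (finProdFinEquiv.symm a.2).1) *
        u k 1 (enc 0 (finProdFinEquiv.symm a.1).2 (finProdFinEquiv.symm a.2).2))
    (fun k (b : Fin (N * N) × Fin d) =>
      u k 2 (enc (finProdFinEquiv.symm b.1).1 (finProdFinEquiv.symm b.1).2 (Fin.castLE hdN b.2)))
    (fun k (c : Fin d × Fin (N * N)) =>
      u k 3 (enc (finProdFinEquiv.symm c.2).1 (finProdFinEquiv.symm c.2).2 (Fin.castLE hdN c.1))) ?_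
  funext a b c
  have hpt := congrFun hu
    (fun v => enc (dLabels hdN a b c v 0) (dLabels hdN a b c v 1) (dLabels hdN a b c v 2))
  rw [Finset.sum_apply, diagTetra_dLabels hd hdN] at hpt
  rw [← hpt, Finset.sum_apply, Finset.sum_apply, Finset.sum_apply]
  refine Finset.sum_congr rfl fun k _ => ?_
  rw [rankOneTensor_apply, Fin.prod_univ_four, triad_apply]
  simp only [dLabels, groupLabels, Matrix.cons_val_zero, Matrix.cons_val_one, Matrix.cons_val_two,
    Matrix.cons_val_three, Matrix.head_cons, Matrix.tail_cons]

end Grouping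

/-! ## §3b Definitions used by the downstream files (`TetraDiagonalLadder`, `TetraDiagonalCover`) -/

section Defs

variable (F : Type) [Field F]

/-- Admissible exponents of the thin-diagonal family `n ↦ Z_n^{(⌈n^ε⌉)}`:
`{β | R₄(Z_n^{(⌈n^ε⌉)}) = O(n^β)}`. (CVZ19 Def. 1.1.13, non-uniform dimension function). -/
def diagAdmissibleExponents (ε : ℝ) : Set ℝ :=
  {β : ℝ | (fun n : ℕ => (tensorRankD (diagTetra F n (rectDim n ε)) : ℝ)) =O[atTop]
    fun n : ℕ => (n : ℝ) ^ β}

/-- **The thin-diagonal exponent** `ω_diag(ε) = inf {β | R₄(Z_n^{(⌈n^ε⌉)}) = O(n^β)}`; `ω_diag(1) = ω(K₄)`.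
(CVZ19 Def. 1.1.25, non-uniform dimensions). -/
def omegaDiag (ε : ℝ) : ℝ :=
  sInf (diagAdmissibleExponents F ε)

end Defs

section CycleLabels

/-- Extension of a labelling of the 4-cycle `02, 03, 12, 13` by the frozen label `0` on the matching
`01, 23` (edge order `01, 02, 03, 12, 13, 23` of `vertexLabels`). -/
def cycExt {N : ℕ} [NeZero N] (e : Fin 4 → Fin N) : Fin 6 → Fin N :=
  ![0, e 0, e 1, e 2, e 3, 0]

/-- Read the four 4-cycle labels off a 4-tuple of vertex label triples. -/
def cycDec {N : ℕ} (L : Fin 4 → Fin 3 → Fin N) : Fin 4 → Fin N :=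
  ![L 0 1, L 0 2, L 1 1, L 1 2]

/-- `cycDec` is a left inverse of `vertexLabels ∘ cycExt`. -/
theorem cycDec_vertexLabels_cycExt {N : ℕ} [NeZero N] (e : Fin 4 → Fin N) :
    cycDec (vertexLabels (cycExt e)) = e := by
  funext k
  fin_cases k <;> simp [cycDec, cycExt, vertexLabels]

/-- On consistent 4-tuples with both matching labels `0`, `vertexLabels ∘ cycExt ∘ cycDec` is the
identity. -/
theorem vertexLabels_cycExt_cycDec {N : ℕ} [NeZero N] {L : Fin 4 → Fin 3 → Fin N}
    (hL : consistent L = true) (h0 : L 0 0 = 0) (h2 : L 2 2 = 0) :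
    vertexLabels (cycExt (cycDec L)) = L := by
  obtain ⟨h₁, h₂, h₃, h₄, h₅, h₆⟩ := (consistent_iff L).1 hL
  have h10 : L 1 0 = 0 := h₁ ▸ h0
  have h32 : L 3 2 = 0 := h₆ ▸ h2
  funext v j
  fin_cases v <;> fin_cases j <;>
    simp [cycDec, cycExt, vertexLabels, h₂, h₃, h₄, h₅, h0, h2, h10, h32]

end CycleLabels

end Summit.MatrixMultiplication.MatrixMultiplication.Theorems.TetraDiagonal

end
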